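import Literature.Probability.LatticeModels.ScaleFrameKernelPaths
import Literature.Probability.LatticeModels.ScaleFrameQuasiMultGlue
import Literature.Probability.LatticeModels.ScaleFrameQuasiMultUpper
import Literature.Probability.LatticeModels.RandomClusterArmConditioningOff
import HarnessLib

/-!
# The junk of the top-level decomposition on a scale frame: no separator in `m/2` odd sub-annuli
(proved)

Topic `Literature/Probability/LatticeModels` (trunk `StatMech`, family `crit-ising`). In Kesten's
ratio-limit scheme (H. Kesten, PTRF 73 (1986), proof of Thm. 3, the estimate "(8)") in the
planarity-free form of Basu–Sapozhnikov (ECP 22 (2017), §2) on a scale frame `F` whose edges are the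
edges of a finite graph `G`, the top-level identity `openConn_eq_sum_add_notWiredOff`
(`BlockExplorationTopOff.lean`) leaves the junk event
`NW = {the rim of the exploration of the block Blk = annSet a_K (a_K M^m) from In = inSet a_K is not
wired off the inside}` (`a_K = a M^K`). Here it is bounded:

* `ScaleFrame.disjoint_edgesTouching_annSet` — frame edges touching two geometric sub-annuli two
  scales apart are distinct (frame continuity);
* `ScaleFrame.sep_cond_lower` — the RSW clause `SepBound` of a sub-annulus, through the conditional
  domination of the region by its free measure (`rcMeasure_real_inter_cylinder_le_mul_fromEdgeSet_of_isLowerSet`),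
  gives the separator of the sub-annulus conditional probability `≥ c` given ANY configuration off
  the edges touching the sub-annulus;
* `ScaleFrame.real_inter_notWiredOff_le` — for every increasing `A`,
  `φ_G(A ∩ NW) ≤ (1-c)^{m/2} φ_G(A)`: an open separator of any sub-annulus `(a_K M^i, a_K M^{i+1})`,
  `1 ≤ i`, `i + 1 ≤ m`, wires the rim off the inside (`explRimWiredOff_of_sepEvent_in`), the `m/2` odd
  sub-annuli have pairwise disjoint edge sets, and the successive conditioning of
  `rcMeasure_real_inter_inter_biInter_compl_le` applies.

Everything is proved; no definitions, no named facts.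

## References

* [Kesten1986] H. Kesten, The incipient infinite cluster in two-dimensional percolation, *Probab.
  Theory Related Fields* 73 (1986) 369–394, proof of Thm. 3.
* [BasuSapozhnikov2017ECP] D. Basu, A. Sapozhnikov, ECP 22 (2017) no. 26, §2.
* G. Grimmett, *The Random-Cluster Model*, Springer (2006), Lemma (4.13), Thm. (3.8)(b).
-/

open MeasureTheory Finset SimpleGraph
open Literature.Probability.Percolation (BondConfig openConn openConnIn explSet explRim explEvent)

namespace Literature.Probability.LatticeModels

namespace ScaleFrame

variable {V : Type*} [Fintype V] [DecidableEq V] (F : ScaleFrame V)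

/-! ### Frame geometry: odd sub-annuli have disjoint edge sets -/

/-- **Frame edges touching two geometric sub-annuli two scales apart are distinct**: an edge of the
frame at a good vertex of radius `< bM^{i+1} ≤ Rmax` moves the radius by `< η ≤ b`, while the annuli
`(bM^i, bM^{i+1})` and `(bM^j, bM^{j+1})`, `j ≥ i + 2`, are `≥ bM^{i+1}(M-1) ≥ b` apart.
[cite: Kesten1986, §2 (the annuli A_i are separated)] -/
theorem disjoint_edgesTouching_annSet {b M : ℝ} (hb : 0 < b) (hM : 4 ≤ M) (hη : F.η ≤ b)
    {i j : ℕ} (hij : i + 2 ≤ j) (hR : b * M ^ (i + 1) ≤ F.Rmax) :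
    Disjoint (F.edgesTouching (F.annSet (b * M ^ i) (b * M ^ (i + 1))))
      (F.edgesTouching (F.annSet (b * M ^ j) (b * M ^ (j + 1)))) := by
  rw [Finset.disjoint_left]
  intro e he he'
  obtain ⟨heE, u, hu, hug, -, hu2⟩ := F.mem_edgesTouching.1 he
  obtain ⟨-, v, hv, -, hv1, -⟩ := F.mem_edgesTouching.1 he'
  obtain ⟨-, hvu⟩ := F.adj_good e heE u hu v hv hug (hu2.trans_le hR)
  have h1 : b * M ^ (i + 1) + b ≤ b * M ^ (i + 2) := scale_gap hb hM (by omega)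
  have h2 : b * M ^ (i + 2) ≤ b * M ^ j := scale_mono hb hM hij
  have h3 := (abs_lt.1 hvu).2
  linarith

/-! ### The conditional separator bound of a sub-annulus -/

/-- **A likely separator stays likely given the outside** (Kesten 1986, proof of Thm. 3; Grimmett
2006, Lemma (4.13)): if the frame satisfies `SepBound p q c s s'` and the frame edges `U` touching
the annulus `(s, s')` are edges of `G`, then for every configuration `ξ` off `U`,
`c · φ_G{ω ∖ U = ξ} ≤ φ_G({ω ∩ U ∈ sepEvent s s'} ∩ {ω ∖ U = ξ})`: conditionally on the outside,
the DECREASING event "no separator inside `U`" is at most as likely as under the free measure of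
`⟨U⟩`, where it has probability `≤ 1 - c`. [cite: Kesten1986, proof of Thm. 3] -/
theorem sep_cond_lower (G : SimpleGraph V) [DecidableRel G.Adj] {p q c s s' : ℝ}
    (hp : p ∈ Set.Icc (0 : ℝ) 1) (hq : 1 ≤ q) (hSB : F.SepBound p q c s s')
    (hU : F.edgesTouching (F.annSet s s') ⊆ G.edgeFinset) (ξ : Set (Sym2 V)) :
    c * (rcMeasure G p q ∅).real
        {ω | ω ∩ (↑(F.edgesTouching (F.annSet s s')) : Set (Sym2 V))ᶜ = ξ} ≤
      (rcMeasure G p q ∅).real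
        ({ω | ω ∩ (↑(F.edgesTouching (F.annSet s s')) : Set (Sym2 V)) ∈ F.sepEvent s s'} ∩
          {ω | ω ∩ (↑(F.edgesTouching (F.annSet s s')) : Set (Sym2 V))ᶜ = ξ}) := by
  set U : Finset (Sym2 V) := F.edgesTouching (F.annSet s s') with hUdef
  have hq0 : 0 < q := one_pos.trans_le hq
  haveI := isProbabilityMeasure_rcMeasure G hp hq0 ∅
  haveI := isProbabilityMeasure_rcMeasure (fromEdgeSet (U : Set (Sym2 V))) hp hq0 ∅
  set P := rcMeasure G p q ∅ with hPdef
  set Cyl : Set (BondConfig V) := {ω | ω ∩ (↑U : Set (Sym2 V))ᶜ = ξ} with hCyl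
  set S : Set (BondConfig V) := {ω | ω ∩ (↑U : Set (Sym2 V)) ∈ F.sepEvent s s'} with hSdef
  have hD : IsLowerSet (F.sepEvent s s')ᶜ := (F.isUpperSet_sepEvent s s').compl
  -- conditional domination of the decreasing event "no separator inside `U`"
  have hdom := rcMeasure_real_inter_cylinder_le_mul_fromEdgeSet_of_isLowerSet G hp hq ∅ U hU ξ hD
  have hcU : (rcMeasure (fromEdgeSet (U : Set (Sym2 V))) p q ∅).real (F.sepEvent s s')ᶜ ≤ 1 - c := by
    rw [probReal_compl_eq_one_sub MeasurableSet.of_discrete]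
    have h : c ≤ (rcMeasure (fromEdgeSet (U : Set (Sym2 V))) p q ∅).real (F.sepEvent s s') := hSB
    linarith
  -- split the cylinder along `S`
  have hsplit : P.real (Cyl ∩ S) + P.real (Cyl \ S) = P.real Cyl :=
    measureReal_inter_add_sdiff MeasurableSet.of_discrete
  have hdiff : Cyl \ S = {ω | ω ∩ (↑U : Set (Sym2 V)) ∈ (F.sepEvent s s')ᶜ} ∩ Cyl := by
    ext ω
    simp only [Set.mem_sdiff, Set.mem_inter_iff, hSdef, Set.mem_setOf_eq, Set.mem_compl_iff]
    exact and_comm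
  have hle : P.real (Cyl \ S) ≤ P.real Cyl * (1 - c) := by
    rw [hdiff]
    exact hdom.trans (mul_le_mul_of_nonneg_left hcU measureReal_nonneg)
  rw [Set.inter_comm S Cyl]
  nlinarith [hsplit, hle, measureReal_nonneg (μ := P) (s := Cyl)]

/-! ### The junk bound -/

/-- **No separator in any odd sub-annulus is exponentially unlikely, given an increasing event**
(Kesten 1986, proof of Thm. 3, estimate (8)): on a scale frame whose edges are the edges of `G`, with
an RSW ladder of span `b ≥ 1` on the scales `a, …, aM^n`, `K + m ≤ n`, `aM^{K+m} ≤ Rmax`, `η ≤ a`,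
`M ≥ 4`, `c ≤ 1`, `q ≥ 1`, for every increasing `A`:
`φ_G(A ∩ ⋂_{k < m/2} {no open separator of (a_K M^{2k+1}, a_K M^{2k+2}) among its touching edges})
≤ (1-c)^{m/2} φ_G(A)`, `a_K = aM^K` (pairwise edge-disjoint sub-annuli, each conditionally likely:
`rcMeasure_real_inter_inter_biInter_compl_le`). [cite: Kesten1986, proof of Thm. 3] -/
theorem real_inter_biInter_noSep_le (G : SimpleGraph V) [DecidableRel G.Adj] {p q c a M : ℝ}
    {m n b : ℕ} (K : ℕ) (hp : p ∈ Set.Icc (0 : ℝ) 1) (hq : 1 ≤ q) (hc1 : c ≤ 1) (ha : 0 < a)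
    (hM : 4 ≤ M) (hη : F.η ≤ a) (hE : F.E = G.edgeFinset) (hR : a * M ^ (K + m) ≤ F.Rmax)
    (hn : K + m ≤ n) (hb : 1 ≤ b) (hL : F.LadderRSWb p q c a M n b) {A : Set (BondConfig V)}
    (hA : IsUpperSet A) :
    (rcMeasure G p q ∅).real (A ∩ ⋂ i ∈ (Finset.range (m / 2)).map
        ⟨fun k => 2 * k + 1, fun k l (h : 2 * k + 1 = 2 * l + 1) => by omega⟩,
        {ω | ω ∩ (↑(F.edgesTouching (F.annSet (a * M ^ K * M ^ i) (a * M ^ K * M ^ (i + 1)))) :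
          Set (Sym2 V)) ∈ F.sepEvent (a * M ^ K * M ^ i) (a * M ^ K * M ^ (i + 1))}ᶜ) ≤
      (1 - c) ^ (m / 2) * (rcMeasure G p q ∅).real A := by
  set aK : ℝ := a * M ^ K with haK
  have haK0 : 0 < aK := by positivity
  have haaK : a ≤ aK := le_mul_of_one_le_right ha.le (one_le_pow₀ (by linarith))
  have hpow : ∀ t : ℕ, aK * M ^ t = a * M ^ (K + t) := fun t => by rw [haK, pow_add, mul_assoc]
  -- the odd sub-annuli, their edges and separators
  set sOdd : Finset ℕ := (Finset.range (m / 2)).map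
    ⟨fun k => 2 * k + 1, fun k l (h : 2 * k + 1 = 2 * l + 1) => by omega⟩ with hsOdd
  have hmem : ∀ i ∈ sOdd, i + 1 ≤ m ∧ ∀ j ∈ sOdd, i ≠ j → i + 2 ≤ j ∨ j + 2 ≤ i := by
    intro i hi
    simp only [hsOdd, Finset.mem_map, Finset.mem_range, Function.Embedding.coeFn_mk] at hi
    obtain ⟨k, hk, rfl⟩ := hi
    refine ⟨by omega, fun j hj hne => ?_⟩
    simp only [hsOdd, Finset.mem_map, Finset.mem_range, Function.Embedding.coeFn_mk] at hj
    obtain ⟨l, -, rfl⟩ := hj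
    omega
  set U : ℕ → Finset (Sym2 V) := fun i =>
    F.edgesTouching (F.annSet (aK * M ^ i) (aK * M ^ (i + 1))) with hUdef
  set S : ℕ → Set (BondConfig V) := fun i =>
    {ω | ω ∩ (↑(U i) : Set (Sym2 V)) ∈ F.sepEvent (aK * M ^ i) (aK * M ^ (i + 1))} with hSdef
  have hUE : ∀ i, U i ⊆ G.edgeFinset := fun i e he => hE ▸ (F.mem_edgesTouching.1 he).1
  have hRi : ∀ i ∈ sOdd, aK * M ^ (i + 1) ≤ F.Rmax := fun i hi => by
    rw [hpow]
    have := (hmem i hi).1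
    exact (scale_mono ha hM (by omega : K + (i + 1) ≤ K + m)).trans hR
  have hdisj : (↑sOdd : Set ℕ).Pairwise fun i j => Disjoint (U i) (U j) := by
    intro i hi j hj hne
    rcases (hmem i hi).2 j hj hne with h | h
    · exact F.disjoint_edgesTouching_annSet haK0 hM (hη.trans haaK) h (hRi i hi)
    · exact (F.disjoint_edgesTouching_annSet haK0 hM (hη.trans haaK) h (hRi j hj)).symm
  have hS : ∀ i ∈ sOdd, IsUpperSet (S i) := fun i _ ω₁ ω₂ h h₁ =>
    F.isUpperSet_sepEvent _ _ (Set.inter_subset_inter_left _ h) h₁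
  have hSdet : ∀ i ∈ sOdd, ∀ ω₁ ω₂ : BondConfig V,
      ω₁ ∩ ↑(U i) = ω₂ ∩ ↑(U i) → (ω₁ ∈ S i ↔ ω₂ ∈ S i) := fun i _ ω₁ ω₂ h => by
    simp only [hSdef, Set.mem_setOf_eq, h]
  have hc : ∀ i ∈ sOdd, ∀ ξ : Finset (Sym2 V), ξ ⊆ G.edgeFinset \ U i →
      c * (rcMeasure G p q ∅).real {ω | ω ∩ (↑(U i) : Set (Sym2 V))ᶜ = ↑ξ} ≤
        (rcMeasure G p q ∅).real (S i ∩ {ω | ω ∩ (↑(U i) : Set (Sym2 V))ᶜ = ↑ξ}) := by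
    intro i hi ξ _
    have hSB : F.SepBound p q c (aK * M ^ i) (aK * M ^ (i + 1)) := by
      rw [hpow, hpow, show K + (i + 1) = (K + i) + 1 by ring]
      have := (hmem i hi).1
      exact hL.sepBound F hb (by omega)
    exact F.sep_cond_lower G hp hq hSB (hUE i) _
  have key := rcMeasure_real_inter_inter_biInter_compl_le G hp hq ∅ sOdd U hdisj S hS hSdet
    (fun _ => c) (fun _ _ => hc1) hc hA (F := Set.univ) (fun _ _ _ _ _ => Iff.rfl)
  rw [Set.inter_univ, Finset.prod_const, hsOdd, Finset.card_map, Finset.card_range] at key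
  exact key

/-- **The junk of the top-level decomposition is small** (Kesten 1986, proof of Thm. 3, estimate (8);
Basu–Sapozhnikov 2017, §2): on a scale frame `F` whose edges are the edges of `G`, with an RSW
ladder of span `b ≥ 1` on the scales `a, aM, …, aM^n`, `K + m ≤ n`, `aM^{K+m} ≤ Rmax`, `η ≤ a`,
`M ≥ 4`, `c ≤ 1`, `q ≥ 1`: for every increasing event `A`, the event that the rim of the exploration
of the block `annSet (aM^K) (aM^K M^m)` from `inSet (aM^K)` is NOT wired off the inside costs
`φ_G(A ∩ NW) ≤ (1-c)^{m/2} φ_G(A)` — an open separator in any of the `m/2` odd sub-annuli (pairwise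
edge-disjoint) wires the rim off the inside (`explRimWiredOff_of_sepEvent_in`), and none of them
occurring is exponentially unlikely (`real_inter_biInter_noSep_le`). [cite: Kesten1986, proof of Thm. 3] -/
theorem real_inter_notWiredOff_le (G : SimpleGraph V) [DecidableRel G.Adj] {p q c a M : ℝ}
    {m n b : ℕ} (K : ℕ) (hp : p ∈ Set.Icc (0 : ℝ) 1) (hq : 1 ≤ q) (hc1 : c ≤ 1) (ha : 0 < a)
    (hM : 4 ≤ M) (hη : F.η ≤ a) (hE : F.E = G.edgeFinset) (hR : a * M ^ (K + m) ≤ F.Rmax)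
    (hn : K + m ≤ n) (hb : 1 ≤ b) (hL : F.LadderRSWb p q c a M n b) {A : Set (BondConfig V)}
    (hA : IsUpperSet A) :
    (rcMeasure G p q ∅).real (A ∩ {ω | ¬ (∀ r ∈ explRim (F.inSet (a * M ^ K))
        (F.annSet (a * M ^ K) (a * M ^ K * M ^ m)) (ω ∩ (↑G.edgeFinset : Set (Sym2 V))),
        ∀ r₂ ∈ explRim (F.inSet (a * M ^ K)) (F.annSet (a * M ^ K) (a * M ^ K * M ^ m))
          (ω ∩ (↑G.edgeFinset : Set (Sym2 V))),
        ∃ v ∈ explSet (F.inSet (a * M ^ K)) (F.annSet (a * M ^ K) (a * M ^ K * M ^ m))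
            (ω ∩ (↑G.edgeFinset : Set (Sym2 V))) \ F.inSet (a * M ^ K),
        ∃ v' ∈ explSet (F.inSet (a * M ^ K)) (F.annSet (a * M ^ K) (a * M ^ K * M ^ m))
            (ω ∩ (↑G.edgeFinset : Set (Sym2 V))) \ F.inSet (a * M ^ K),
          s(v, r) ∈ ω ∩ (↑G.edgeFinset : Set (Sym2 V)) ∧
          s(v', r₂) ∈ ω ∩ (↑G.edgeFinset : Set (Sym2 V)) ∧
          ω ∩ (↑G.edgeFinset : Set (Sym2 V)) ∈
            openConnIn (explSet (F.inSet (a * M ^ K)) (F.annSet (a * M ^ K) (a * M ^ K * M ^ m))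
              (ω ∩ (↑G.edgeFinset : Set (Sym2 V))) \ F.inSet (a * M ^ K)) v v')}) ≤
      (1 - c) ^ (m / 2) * (rcMeasure G p q ∅).real A := by
  have hq0 : 0 < q := one_pos.trans_le hq
  refine le_trans (rcMeasure_real_mono_of_forall_subset_edgeSet G hp hq0 ∅ ?_)
    (F.real_inter_biInter_noSep_le G K hp hq hc1 ha hM hη hE hR hn hb hL hA)
  -- on lattice configurations, a separator in an odd sub-annulus wires the rim off the inside
  rintro ω - ⟨hωA, hNW⟩
  refine ⟨hωA, Set.mem_iInter₂.2 fun i hi hSi => hNW ?_⟩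
  simp only [Finset.mem_map, Finset.mem_range, Function.Embedding.coeFn_mk] at hi
  obtain ⟨k, hk, rfl⟩ := hi
  have haK0 : 0 < a * M ^ K := by positivity
  have hUE : F.edgesTouching (F.annSet (a * M ^ K * M ^ (2 * k + 1))
      (a * M ^ K * M ^ (2 * k + 1 + 1))) ⊆ G.edgeFinset := fun e he =>
    hE ▸ (F.mem_edgesTouching.1 he).1
  have hωE : ω ∩ (↑G.edgeFinset : Set (Sym2 V)) ⊆ (↑F.E : Set (Sym2 V)) := fun e he => by
    rw [hE]; exact he.2
  have hsep : ω ∩ (↑G.edgeFinset : Set (Sym2 V)) ∈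
      F.sepEvent (a * M ^ K * M ^ (2 * k + 1)) (a * M ^ K * M ^ (2 * k + 1 + 1)) :=
    F.isUpperSet_sepEvent _ _ (fun e he => ⟨he.1, Finset.mem_coe.2 (hUE he.2)⟩) hSi
  have h1 : (1 : ℝ) ≤ M ^ (2 * k + 1) := one_le_pow₀ (by linarith)
  have hai : a * M ^ K ≤ a * M ^ K * M ^ (2 * k + 1) := le_mul_of_one_le_right haK0.le h1
  have hM0 : 0 < M := by linarith
  have hii : a * M ^ K * M ^ (2 * k + 1) < a * M ^ K * M ^ (2 * k + 1 + 1) := by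
    rw [show a * M ^ K * M ^ (2 * k + 1 + 1) = a * M ^ K * M ^ (2 * k + 1) * M by ring]
    exact lt_mul_of_one_lt_right (mul_pos haK0 (pow_pos hM0 _)) (by linarith : (1 : ℝ) < M)
  have him : a * M ^ K * M ^ (2 * k + 1 + 1) ≤ a * M ^ K * M ^ m :=
    mul_le_mul_of_nonneg_left (pow_le_pow_right₀ (by linarith) (by omega)) haK0.le
  exact F.explRimWiredOff_of_sepEvent_in hωE hai hii him hsep

end ScaleFrame

end Literature.Probability.LatticeModels
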